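import Literature.Probability.Percolation.StaircaseTable
import HarnessLib

/-!
# The key gaps of one move of the staircase schedule

Topic: Probability / Percolation; family `crit-perc`. A brick of the GENERIC landing layer of
Nolin's arm-separation theorem (Nolin 2008, Thm. 11, §4.4 [arXiv 0711.4948: Thm. 10, p. 12,
Fig. 6: "RSW in corridors"]), towards
`Literature.Probability.Percolation.Nolin2008_prop17_quasiMult` (`FiveArmExponentFacts.lean`).

One level of the table (`StaircaseTable.lean`) moves one key `p mv ↦ p' mv` within its gap
(`table_succ_right` / `table_succ_left`). This file extracts, for every OTHER key `p b`, the
cyclic key gaps used by `indexGap_of_keyGap` (`StaircaseKeyGap.lean`): up to a number of turns,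
`p b` lies at least `δ` beyond the far end of the move and at least `δ` before the near end plus
a turn (`Staircase.moveGap_right`, `Staircase.moveGap_left`), from the invariant `Inv C δ p`
(chained: `Staircase.Inv.add_le_of_lt`).

## Main results

* `Staircase.Inv.add_le_of_lt` — `p i + δ ≤ p j` for `i < j` (`0 ≤ δ`);
* `Staircase.moveGap_right`, `Staircase.moveGap_left`.

## References

* P. Nolin, *Near-critical percolation in two dimensions*, Electron. J. Probab. 13 (2008), §4.4
  (arXiv 0711.4948: proof of Thm. 10, p. 12, Fig. 6). [Nolin2008]
-/

namespace Literature.Probability.Percolation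

namespace Staircase

variable {k : ℕ} {C δ : ℤ} {p : Fin k → ℤ}

/-- `a ≤ ⟨n, _⟩` from `a.val ≤ n`. [folklore] -/
theorem fin_le_mk {a : Fin k} {n : ℕ} (hn : n < k) (h : a.val ≤ n) : a ≤ ⟨n, hn⟩ := Fin.le_def.2 h

/-- `⟨n, _⟩ ≤ a` from `n ≤ a.val`. [folklore] -/
theorem mk_le_fin {a : Fin k} {n : ℕ} (hn : n < k) (h : n ≤ a.val) : (⟨n, hn⟩ : Fin k) ≤ a := Fin.le_def.2 h

/-- **Chained gaps**: under the invariant with `δ ≥ 0`, `p i + δ ≤ p j` whenever `i < j`. [folklore] -/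
theorem Inv.add_le_of_lt (hI : Inv C δ p) (hδ : 0 ≤ δ) {i j : Fin k} (hij : i < j) : p i + δ ≤ p j := by
  suffices H : ∀ d : ℕ, ∀ (i j : Fin k), j.val = i.val + d + 1 → p i + δ ≤ p j by
    exact H (j.val - i.val - 1) i j (by have := Fin.lt_def.1 hij; omega)
  intro d
  induction d with
  | zero => intro i j h; exact hI.1 i j (by omega)
  | succ d ih =>
    intro i j h
    have hj : i.val + d + 1 < k := by have := j.isLt; omega
    have h1 := ih i ⟨i.val + d + 1, hj⟩ rfl
    have h2 := hI.1 ⟨i.val + d + 1, hj⟩ j (by simp only; omega)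
    linarith

/-- Under the invariant with `δ ≥ 0`, `p i ≤ p j` whenever `i ≤ j`. [folklore] -/
theorem Inv.le_of_le (hI : Inv C δ p) (hδ : 0 ≤ δ) {i j : Fin k} (hij : i ≤ j) : p i ≤ p j := by
  rcases hij.lt_or_eq with h | h
  · have := hI.add_le_of_lt hδ h; linarith
  · rw [h]

/-- **The key gaps of a right move**: if only `mv` moves, forward and by at most its right
bound minus `δ` (`p mv ≤ p' mv ≤ rb C p mv - δ`), then every other key `p b` satisfies, up to
turns, `p' mv + δ ≤ p b + tC ≤ p mv + C - δ`. [cite: Nolin2008, §4.4 (arXiv 0711.4948: proof of Thm. 10, p. 12, Fig. 6)] -/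
theorem moveGap_right (hI : Inv C δ p) (hδ : 0 ≤ δ) {p' : Fin k → ℤ} {mv : Fin k}
    (hup : p' mv ≤ rb C p mv - δ) {b : Fin k} (hb : b ≠ mv) :
    ∃ t : ℤ, p' mv + δ ≤ p b + t * C ∧ p b + t * C + δ ≤ p mv + C := by
  have hk : 0 < k := Fin.pos mv
  have h0mv : p ⟨0, hk⟩ ≤ p mv := hI.le_of_le hδ (mk_le_fin hk (Nat.zero_le _))
  have hlast : p mv ≤ p ⟨k - 1, by omega⟩ := hI.le_of_le hδ (fin_le_mk (by omega) (by have := mv.isLt; omega))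
  have hwrap := hI.2 ⟨k - 1, by omega⟩ ⟨0, hk⟩ (show k - 1 + 1 = k by omega) rfl
  rcases lt_or_gt_of_ne hb with hlt | hgt
  · -- `b` before `mv`: one turn
    refine ⟨1, ?_, ?_⟩
    · have hb0 : p ⟨0, hk⟩ ≤ p b := hI.le_of_le hδ (mk_le_fin hk (Nat.zero_le _))
      unfold rb at hup
      split_ifs at hup with h
      · have h1 : p ⟨mv.val + 1, h⟩ ≤ p ⟨k - 1, by omega⟩ := hI.le_of_le hδ (Fin.mk_le_mk.2 (by omega))
        linarith
      · linarith
    · have := hI.add_le_of_lt hδ hlt; linarith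
  · -- `b` after `mv`: no turn
    refine ⟨0, ?_, ?_⟩
    · unfold rb at hup
      have h : mv.val + 1 < k := by have := Fin.lt_def.1 hgt; have := b.isLt; omega
      rw [dif_pos h] at hup
      have h1 : p ⟨mv.val + 1, h⟩ ≤ p b := hI.le_of_le hδ (mk_le_fin h (by have := Fin.lt_def.1 hgt; omega))
      linarith
    · have h1 : p b ≤ p ⟨k - 1, by omega⟩ := hI.le_of_le hδ (fin_le_mk (by omega) (by have := b.isLt; omega))
      linarith

/-- **The key gaps of a left move**: if only `mv` moves, backward and by at most its left bound
plus `δ` (`lb C p mv + δ ≤ p' mv ≤ p mv`), then every other key `p b` satisfies, up to turns,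
`p mv + δ ≤ p b + tC ≤ p' mv + C - δ`. [cite: Nolin2008, §4.4 (arXiv 0711.4948: proof of Thm. 10, p. 12, Fig. 6)] -/
theorem moveGap_left (hI : Inv C δ p) (hδ : 0 ≤ δ) {p' : Fin k → ℤ} {mv : Fin k}
    (hlo : lb C p mv + δ ≤ p' mv) {b : Fin k} (hb : b ≠ mv) :
    ∃ t : ℤ, p mv + δ ≤ p b + t * C ∧ p b + t * C + δ ≤ p' mv + C := by
  have hk : 0 < k := Fin.pos mv
  have hwrap := hI.2 ⟨k - 1, by omega⟩ ⟨0, hk⟩ (show k - 1 + 1 = k by omega) rfl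
  rcases lt_or_gt_of_ne hb with hlt | hgt
  · -- `b` before `mv`: one turn
    refine ⟨1, ?_, ?_⟩
    · have h1 : p mv ≤ p ⟨k - 1, by omega⟩ := hI.le_of_le hδ (fin_le_mk (by omega) (by have := mv.isLt; omega))
      have hb0 : p ⟨0, hk⟩ ≤ p b := hI.le_of_le hδ (mk_le_fin hk (Nat.zero_le _))
      linarith
    · unfold lb at hlo
      have h : 1 ≤ mv.val := by have := Fin.lt_def.1 hlt; omega
      rw [dif_pos h] at hlo
      have h1 : p b ≤ p ⟨mv.val - 1, by omega⟩ := hI.le_of_le hδ (fin_le_mk (by omega) (by have := Fin.lt_def.1 hlt; omega))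
      linarith
  · -- `b` after `mv`: no turn
    refine ⟨0, ?_, ?_⟩
    · have := hI.add_le_of_lt hδ hgt; linarith
    · unfold lb at hlo
      split_ifs at hlo with h
      · have h1 : p b ≤ p ⟨k - 1, by omega⟩ := hI.le_of_le hδ (fin_le_mk (by omega) (by have := b.isLt; omega))
        have h2 : p ⟨0, hk⟩ ≤ p ⟨mv.val - 1, by omega⟩ := hI.le_of_le hδ (Fin.mk_le_mk.2 (Nat.zero_le _))
        linarith
      · have h1 : p b ≤ p ⟨k - 1, by omega⟩ := hI.le_of_le hδ (fin_le_mk (by omega) (by have := b.isLt; omega))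
        linarith

end Staircase

end Literature.Probability.Percolation
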